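import Summits.BirchSwinnertonDyer.BirchSwinnertonDyer.Theorems.ByReductionTypeAtTwoRankOneAtTwoBigImageOddLocalOneDoorKolyvaginExactBridge
import Summits.BirchSwinnertonDyer.BirchSwinnertonDyer.Theorems.ByReductionTypeAtTwoRankOneAtTwoBigImageOddLocalOneDoorGlue
import Literature.NumberTheory.EllipticCurves.NonvanishingTwistsWaldspurgerOfHoffsteinLuo
import Literature.NumberTheory.EllipticCurves.NonvanishingTwistsProofs
import Literature.NumberTheory.EllipticCurves.BSDRootNumberModularityOnlyProofs
import Literature.NumberTheory.EllipticCurves.NoConductorOne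
import Literature.NumberTheory.EllipticCurves.AnalyticRankModularityProofs
import Literature.NumberTheory.EllipticCurves.HeegnerPointsOfConductorOneData
import Literature.NumberTheory.EllipticCurves.HeegnerPointsOfConductorOneRationalityProofs
import Literature.NumberTheory.EllipticCurves.KolyvaginShaStructureIndexFormProofs
import Literature.NumberTheory.QuadraticFields.HeegnerCondition
import HarnessLib

/-!
# Route ByReductionTypeAtTwo, crux `RankOneAtTwoBigImageOddLocal` (stmt-BirchSwinnertonDyer-23715):
# the K-side bridge with its SUPPLY reduced to Kolyvagin's conjecture at `2` (+ Manin)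

Width prover seat `bsd-line-fkl-p2` g7 (2026-08-28), sequel of `…OneDoorKolyvaginExactBridge.lean`; `--supports
stmt-BirchSwinnertonDyer-23715`.  THEOREMS ONLY; nothing asserted; BSD is not proved by any of this.

The bridge `rankOneAtTwoBigImageOddLocal_of_kolyvaginExactAtTwo` takes ONE rank-one Kolyvagin supply binder (a Kolyvagin-admissible
Heegner field, an odd-constant datum, a conductor-`1` Kolyvagin–Heegner datum with `y_K` non-torsion and its `M₀`, and a
`2`-indivisible derived point `P(n)`).  All of it except the last clause (and the odd constant, = the line's `S_manin`) is
theorem-grade, and is PROVED here: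

* §1 `exists_kolyvaginDoorField_of_analyticRank_eq_one` — for `W` globally minimal of analytic rank `1`, modulo modularity as a
  newform and Hoffstein–Luo 1997: an imaginary quadratic `K` with `d_K` ODD, `d_K ≠ −3`, the Heegner hypothesis for `N_W`,
  `d_K·(−|Δ_W|)` and `d_K·(−2|Δ_W|)` NON-SQUARES, `d_K` door-admissible, `L(W^{(d_K)},1) ≠ 0` and `(d_K, N_W) = 1`.  Proof: the
  sign `w(W) = −1` (parity), then `exists_neg_fundamental_twist_ne_zero_of_hoffsteinLuo` with the auxiliary prime set
  `S := primeFactors(2·|num Δ|·den Δ)`: `(d/p) = 1` for `p ∈ S` forces `gcd(d, 2Δ) = 1`, so at any prime `p ∣ d` (square-free,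
  `|d| ≥ 7`) the rationals `d·(−|Δ|)`, `d·(−2|Δ|)` have `p`-adic valuation exactly `1`, hence are not squares; the field is
  `ℚ(√d)` (`exists_heegnerField_iff_exists_fundamental`), and door-admissibility is as in `exists_doorField_of_rootNumber_eq_neg_one`
  (p617200).
* §2 `rankOneAtTwoBigImageOddLocal_of_kolyvaginExactAtTwo_of_kolyvaginConjecture` — the crux BY NAME from PRINT (`gross_zagier`,
  GZK, `exists_isNewformOf`, Hoffstein–Luo, Milne 1972), `KolyvaginExactAtTwo` (route GenusKolyvaginAtTwo, crux 22137, BY NAME),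
  `S_manin`, `S_rankZeroTwin`, and ONE open binder `hKC` = KOLYVAGIN'S CONJECTURE AT `p = 2` in derived-point form on the
  slice's Kolyvagin-admissible doors (for every odd-constant datum and conductor-`1` datum with `y_K` of infinite order, some
  square-free product `n` of Kolyvagin primes at `2` carries a derived point `P(n) ∉ 2E(K[n])`).  The conductor-`1` datum is the
  tree's `exists_kolyvaginHeegnerData_one` (Darmon Thm. 3.6 at conductor `1`, PROVED), `M₀` is
  `exists_pow_smul_eq_and_not_of_not_isOfFinAddOrder` in the number field `K[1]`, `y_K` non-torsion is Gross–Zagier on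
  `L'(W/K,1) = L'(W,1)·L(W^{(d_K)},1) ≠ 0`, the orientation `β` is `Quadratic.exists_dvd_sq_sub_discr_of_ncard_primesOver`.
* §3 `bsdp_two_of_kolyvaginExactAtTwo_at_of_not_two_dvd` — the rows with `y_K ∉ 2E(K[1])` (`M₀ = 0`) need NO conjecture:
  `n = 1` is its own `2`-indivisible derived point.

Net cone of 23715 on this bridge: {PRINT⁵, crux 22137, Kolyvagin's conjecture at 2 (slice doors), `S_manin` (open at `4 ∣ N`),
rank-`0` cruxes}.  Nothing here is asserted.

References: [HoffsteinLuo1997] Theorem (§1); [GrossZagier1986] Thm. I.6.3, V.§2; [GrossLMS1991] §§3–4; [McCallumLMS1991] §5;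
[Darmon2004] Thm. 3.6; [Cox2013] §9.A; [Milne1972ArithmeticAV] §1 Thm. 1; [Miller2011LMS] Def. 1.1.
-/

set_option autoImplicit false
-- the Theorems namespace of this sub repeats the summit name by design (D-0017 nested layout)
set_option linter.dupNamespace false

noncomputable section

open scoped Classical

namespace Summit.BirchSwinnertonDyer.BirchSwinnertonDyer.Theorems.RankOneAtTwoOneDoor

open WeierstrassCurve NumberField Literature.NumberTheory.EllipticCurves Literature.NumberTheory.EllipticCurves.ModularForms
  Literature.NumberTheory.EllipticCurves.Rank1Residual
  Literature.NumberTheory.EllipticCurves.KrizLi2019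
  Summit.BirchSwinnertonDyer.Rank1Residual
  Summit.BirchSwinnertonDyer.Rank1Residual.F1Sign2
  Summit.BirchSwinnertonDyer.Rank1Residual.F1Sign2.TranspositionDoor
  Summit.BirchSwinnertonDyer.BirchSwinnertonDyer.Theses.ByReductionTypeAtTwo
  Summit.BirchSwinnertonDyer.BirchSwinnertonDyer.Theses.GenusKolyvaginAtTwo
  Summit.BirchSwinnertonDyer.BirchSwinnertonDyer.Theorems.CMExactDescent

/-! ### §1 A Kolyvagin-admissible Hoffstein–Luo door -/

/-- `padicValRat` of an absolute value. [folklore] -/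
private theorem padicValRat_abs (p : ℕ) (x : ℚ) : padicValRat p |x| = padicValRat p x := by
  rcases abs_choice x with h | h
  · rw [h]
  · rw [h, padicValRat.neg]

/-- A rational of ODD `p`-adic valuation is not a square. [folklore] -/
private theorem not_isSquare_of_padicValRat_odd (p : ℕ) [Fact p.Prime] {x : ℚ} (hx : x ≠ 0)
    (hv : Odd (padicValRat p x)) : ¬ IsSquare x := by
  rintro ⟨r, hr⟩
  have hr0 : r ≠ 0 := by
    rintro rfl
    exact hx (by rw [hr, mul_zero])
  rw [hr, padicValRat.mul hr0 hr0] at hv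
  exact (Int.not_even_iff_odd.mpr hv) ⟨padicValRat p r, rfl⟩

/-- If an odd prime `p` divides the square-free `d` exactly and is prime to `num Δ · den Δ`, then `v_p(d · (−|Δ|)) = 1` and
`v_p(d · (−2|Δ|)) = 1`. [folklore] -/
private theorem padicValRat_door_products {p : ℕ} [hp : Fact p.Prime] (hp2 : p ≠ 2) {d : ℤ} (hsq : Squarefree d)
    (hpd : (p : ℤ) ∣ d) {Δ : ℚ} (hΔ : Δ ≠ 0) (hnum : ¬ p ∣ Δ.num.natAbs) (hden : ¬ p ∣ Δ.den) :
    padicValRat p ((d : ℚ) * -|Δ|) = 1 ∧ padicValRat p ((d : ℚ) * (-(2 * |Δ|))) = 1 := by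
  have hd0 : d ≠ 0 := hsq.ne_zero
  have hdQ : (d : ℚ) ≠ 0 := by exact_mod_cast hd0
  have hvd : padicValRat p (d : ℚ) = 1 := by
    rw [padicValRat.of_int]
    have hsq' : Squarefree d.natAbs := Int.squarefree_natAbs.mpr hsq
    have h1 : d.natAbs.factorization p = 1 :=
      Nat.factorization_eq_one_of_squarefree hsq' hp.out (Int.ofNat_dvd_left.mp hpd)
    rw [Nat.factorization_def _ hp.out] at h1
    simp [padicValInt, h1]
  have hvΔ : padicValRat p Δ = 0 := by
    rw [padicValRat_def, padicValInt, padicValNat.eq_zero_of_not_dvd hnum, padicValNat.eq_zero_of_not_dvd hden]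
    simp
  have hv2 : padicValRat p (2 : ℚ) = 0 := by
    have h : ¬ p ∣ 2 := fun h => hp2 ((Nat.prime_dvd_prime_iff_eq hp.out Nat.prime_two).mp h)
    rw [show (2 : ℚ) = ((2 : ℕ) : ℚ) by norm_num, padicValRat.of_nat, padicValNat.eq_zero_of_not_dvd h]
    simp
  have habs : |Δ| ≠ 0 := abs_ne_zero.mpr hΔ
  refine ⟨?_, ?_⟩
  · rw [padicValRat.mul hdQ (neg_ne_zero.mpr habs), padicValRat.neg, padicValRat_abs, hvd, hvΔ]; rfl
  · rw [padicValRat.mul hdQ (neg_ne_zero.mpr (mul_ne_zero two_ne_zero habs)), padicValRat.neg,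
      padicValRat.mul two_ne_zero habs, padicValRat_abs, hvd, hvΔ, hv2]; rfl

/-- **A KOLYVAGIN-ADMISSIBLE HOFFSTEIN–LUO DOOR.**  For `W/ℚ` globally minimal of analytic rank `1`, modulo modularity as a newform
(`hmod`) and Hoffstein–Luo 1997 (`hHL`): an imaginary quadratic `K` with `d_K` odd, `d_K ≠ −3`, the Heegner hypothesis for
`N_W`, `d_K·(−|Δ_W|)` and `d_K·(−2|Δ_W|)` non-squares in `ℚ` (so `K ≠ ℚ(√−|Δ|), ℚ(√−2|Δ|)`: route GenusKolyvaginAtTwo's Kolyvagin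
admissibility at `2`), `d_K` door-admissible (line `one_door_analytic`), `L(W^{(d_K)},1) ≠ 0` and `(d_K, N_W) = 1`.
[cite: HoffsteinLuo1997, Theorem (§1, pp. 435–436)] -/
theorem exists_kolyvaginDoorField_of_analyticRank_eq_one (hmod : exists_isNewformOf)
    (hHL : HoffsteinLuo1997_exists_twist_L_one_ne_zero)
    (W : WeierstrassCurve ℚ) [W.IsElliptic] [W.IsGloballyMinimal] (hr : W.analyticRank = 1) :
    ∃ (K : Type) (_ : Field K) (_ : NumberField K),
      IsImaginaryQuadratic K ∧ Odd (NumberField.discr K) ∧ NumberField.discr K ≠ -3 ∧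
      SatisfiesHeegnerHypothesis (W.conductorNorm ℤ) K ∧
      ¬ IsSquare ((NumberField.discr K : ℚ) * -|W.Δ|) ∧ ¬ IsSquare ((NumberField.discr K : ℚ) * (-(2 * |W.Δ|))) ∧
      DoorAdmissible W (NumberField.discr K) ∧
      (W.quadraticTwist (NumberField.discr K : ℚ)).entireLFunction 1 ≠ 0 ∧
      Nat.Coprime (NumberField.discr K).natAbs (W.conductorNorm ℤ) := by
  set N : ℕ := W.conductorNorm ℤ with hN_def
  have hN0 : N ≠ 0 := (W.conductorNorm_pos_holds).ne'
  have hΔ : W.Δ ≠ 0 := W.isUnit_Δ.ne_zero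
  -- the sign
  have hw : W.rootNumber = -1 := by
    have hiff : Even W.analyticRank ↔ W.rootNumber = 1 :=
      even_analyticRank_iff_rootNumber_eq_one_of_exists_isNewformOf W hmod
    rcases rootNumber_eq_one_or_eq_neg_one W with h1 | h1
    · exfalso
      have hev : Even W.analyticRank := hiff.mpr h1
      rw [hr] at hev
      exact Nat.not_even_one hev
    · exact h1
  -- Hoffstein–Luo with the auxiliary primes of `2 · num Δ · den Δ`
  set M : ℕ := 2 * W.Δ.num.natAbs * W.Δ.den with hM_def
  have hM0 : M ≠ 0 := by
    refine mul_ne_zero (mul_ne_zero two_ne_zero ?_) W.Δ.den_nz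
    exact Int.natAbs_ne_zero.mpr (Rat.num_ne_zero.mpr hΔ)
  obtain ⟨d, hdneg, hsq, hd8, -, hjacS, hjacN, hL⟩ :=
    exists_neg_fundamental_twist_ne_zero_of_hoffsteinLuo hmod hHL W hw M.primeFactors 0
  have hd0 : d ≠ 0 := hdneg.ne
  -- no prime of `N` divides `d`
  have hndvd : ∀ p : ℕ, p.Prime → p ∣ N → ¬ (p : ℤ) ∣ d := by
    intro p hp hpN hpd
    by_cases hp2 : p = 2
    · subst hp2
      have : d % 2 = 0 := Int.emod_eq_zero_of_dvd (by exact_mod_cast hpd)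
      omega
    · have hj : jacobiSym d p = 1 := hjacN p hp hpN hp2
      rw [jacobiSym.mod_left, Int.emod_eq_zero_of_dvd hpd, jacobiSym.zero_left hp.one_lt] at hj
      exact zero_ne_one hj
  -- no prime of `2 · num Δ · den Δ` divides `d`
  have hcop : ∀ p : ℕ, p.Prime → (p : ℤ) ∣ d → p ≠ 2 ∧ ¬ p ∣ W.Δ.num.natAbs ∧ ¬ p ∣ W.Δ.den := by
    intro p hp hpd
    have hp2 : p ≠ 2 := by
      rintro rfl
      have : d % 2 = 0 := Int.emod_eq_zero_of_dvd (by exact_mod_cast hpd)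
      omega
    have hnotM : ¬ p ∣ M := by
      intro hpM
      have hj : jacobiSym d p = 1 := hjacS p (Nat.mem_primeFactors.mpr ⟨hp, hpM, hM0⟩) hp hp2
      rw [jacobiSym.mod_left, Int.emod_eq_zero_of_dvd hpd, jacobiSym.zero_left hp.one_lt] at hj
      exact zero_ne_one hj
    refine ⟨hp2, fun h => hnotM ?_, fun h => hnotM ?_⟩
    · exact Dvd.dvd.mul_right (Dvd.dvd.mul_left h 2) _
    · exact Dvd.dvd.mul_left h _
  -- a prime of `d` (`|d| ≥ 7`)
  obtain ⟨p, hp, hpd'⟩ : ∃ p : ℕ, p.Prime ∧ p ∣ d.natAbs := Nat.exists_prime_and_dvd (by omega)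
  have hpd : (p : ℤ) ∣ d := Int.ofNat_dvd_left.mpr hpd'
  haveI : Fact p.Prime := ⟨hp⟩
  obtain ⟨hp2, hnum, hden⟩ := hcop p hp hpd
  obtain ⟨hv1, hv2⟩ := padicValRat_door_products hp2 hsq hpd hΔ hnum hden
  have hdQ : (d : ℚ) ≠ 0 := by exact_mod_cast hd0
  have habs : |W.Δ| ≠ 0 := abs_ne_zero.mpr hΔ
  have hnsq1 : ¬ IsSquare ((d : ℚ) * -|W.Δ|) :=
    not_isSquare_of_padicValRat_odd p (mul_ne_zero hdQ (neg_ne_zero.mpr habs)) (by rw [hv1]; exact odd_one)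
  have hnsq2 : ¬ IsSquare ((d : ℚ) * (-(2 * |W.Δ|))) :=
    not_isSquare_of_padicValRat_odd p (mul_ne_zero hdQ (neg_ne_zero.mpr (mul_ne_zero two_ne_zero habs)))
      (by rw [hv2]; exact odd_one)
  -- the field `K = ℚ(√d)`
  obtain ⟨K, _iF, _iN, hK, -, hHN, hdK⟩ :=
    (exists_heegnerField_iff_exists_fundamental N 0 (fun D => D = d)).mpr
      ⟨d, hdneg, Or.inl ⟨by omega, hsq, by omega⟩, by simpa using Int.natAbs_pos.mpr hd0 |>.ne',
        fun p hp hpN => ⟨fun _ => hd8, fun hp2 => hjacN p hp hpN hp2⟩, rfl⟩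
  refine ⟨K, _iF, _iN, hK, ?_, ?_, hHN, ?_, ?_, ?_, ?_, ?_⟩
  · rw [hdK, Int.odd_iff]; omega
  · rw [hdK]; omega
  · rw [hdK]; exact hnsq1
  · rw [hdK]; exact hnsq2
  · -- door-admissible
    rw [hdK]
    refine ⟨hdneg, hsq, hd8, ?_, ?_⟩
    · intro q hq hqd _hF
      have hqN : ¬ q ∣ N := fun hqN => hndvd q hq hqN hqd
      exact hasGoodReductionAtPrime_of_not_dvd_conductorNorm' W hqN
    · intro ℓ hℓ hℓ2 hbad
      by_cases hℓN : ℓ ∣ N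
      · exact hjacN ℓ hℓ hℓN hℓ2
      · exact absurd (hasGoodReductionAtPrime_of_not_dvd_conductorNorm' W (hℓ := ⟨hℓ⟩) hℓN) (hbad ⟨hℓ⟩)
  · rw [hdK]; exact hL
  · rw [hdK]
    exact Nat.coprime_of_dvd fun p hp hpd hpN => hndvd p hp hpN (Int.ofNat_dvd_left.mpr hpd)

/-! ### §2 The crux from `KolyvaginExactAtTwo`, Manin, rank-`0` `BSD₂`, PRINT and Kolyvagin's conjecture at `2` -/

/-- **Crux `RankOneAtTwoBigImageOddLocal` BY NAME from route GenusKolyvaginAtTwo's `KolyvaginExactAtTwo`, with the rank-one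
Kolyvagin supply DISCHARGED down to Kolyvagin's conjecture at `2`.**  Binders: PRINT — Gross–Zagier (`hGZ`), GZK (`hGZK`),
modularity as a newform (`hnf`), Hoffstein–Luo 1997 (`hHL`), Milne 1972 any-model (`hMilneC`); the sibling route's crux
`KolyvaginExactAtTwo` (`hX`); the odd-constant parametrisation `S_manin` (`hMan`; open only at `4 ∣ N`); rank-`0` `BSD₂` of non-CM
curves `S_rankZeroTwin` (`hZ`, = this route's four rank-`0` cruxes); and `hKC` — KOLYVAGIN'S CONJECTURE AT `p = 2` (derived-point
form) on the slice's Kolyvagin-admissible doors: for `W` on the slice, `K` Kolyvagin-admissible, any odd-constant `Dt`, `β`, `ι` and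
conductor-`1` datum `d₁` with `y_K = P(1)` of infinite order, SOME square-free product `n` of Kolyvagin primes at `2` has a
conductor-`n` datum with `P(n) ∉ 2E(K[n])`.  Everything else of the supply is proved: the door (§1), `β`
(`Quadratic.exists_dvd_sq_sub_discr_of_ncard_primesOver`), `d₁` (`exists_kolyvaginHeegnerData_one`, Darmon Thm. 3.6 PROVED), `y_K`
non-torsion (Gross–Zagier on `L'(W/K,1) = L'(W,1)·L(W^{(d_K)},1) ≠ 0`, injectivity of `E(K) → E(K[1])`), `M₀` (finite
generation of `E(K[1])`).  BSD is not proved by this: conditional by design.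
[cite: GrossLMS1991, §2 Conj. (2.2), §§3–4] [cite: McCallumLMS1991, §5] [cite: Darmon2004, Thm. 3.6] -/
theorem rankOneAtTwoBigImageOddLocal_of_kolyvaginExactAtTwo_of_kolyvaginConjecture
    (hGZ : ∀ (N : ℕ) [NeZero N] (W : WeierstrassCurve ℚ) (K : Type) [Field K] [NumberField K], gross_zagier N W K)
    (hGZK : rank_eq_analyticRank_of_analyticRank_le_one) (hnf : exists_isNewformOf)
    (hHL : HoffsteinLuo1997_exists_twist_L_one_ne_zero) (hMilneC : Milne1972.bsdQuotient_baseChange_quadratic_anyModel)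
    (hX : KolyvaginExactAtTwo) (hMan : S_manin)
    (hKC : ∀ (W : WeierstrassCurve ℚ) [W.IsElliptic] [W.IsGloballyMinimal] [NeZero (W.conductorNorm ℤ)],
      ¬ W.HasCM → (∀ n : ℕ, W.HasSurjectiveModNGaloisRep ((2 ^ n : ℕ) : ℤ)) → Odd W.tamagawaProduct → W.analyticRank = 1 →
      ∀ (K : Type) [Field K] [NumberField K], IsImaginaryQuadratic K → Odd (NumberField.discr K) →
        NumberField.discr K ≠ -3 → SatisfiesHeegnerHypothesis (W.conductorNorm ℤ) K →
        ¬ IsSquare ((NumberField.discr K : ℚ) * -|W.Δ|) → ¬ IsSquare ((NumberField.discr K : ℚ) * (-(2 * |W.Δ|))) →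
        ∀ (Dt : ModularParametrizationData W (W.conductorNorm ℤ)) (β : ℤ) (ι : K →+* ℂ) (d₁ : KolyvaginHeegnerData Dt β ι 1),
          Odd Dt.c → ¬ IsOfFinAddOrder d₁.derivedPoint →
          ∃ (n : ℕ) (d : KolyvaginHeegnerData Dt β ι n), Squarefree n ∧
            (∀ ℓ ∈ n.primeFactors, Zhang2014.IsKolyvaginPrime (W.conductorNorm ℤ) W K 2 ℓ) ∧
            ¬ ∃ Q : (W.baseChange (ringClassField K ι n)).toAffine.Point, (2 : ℤ) • Q = d.derivedPoint)
    (hZ : S_rankZeroTwin) : RankOneAtTwoBigImageOddLocal := by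
  intro W _ _ hCM hsurj hT hc hr
  haveI hN : NeZero (W.conductorNorm ℤ) := ⟨(W.conductorNorm_pos_holds).ne'⟩
  have hmod : hasEntireLFunction_rat := hasEntireLFunction_rat_of_exists_isNewformOf hnf
  -- the Kolyvagin-admissible door
  obtain ⟨K, _iF, _iN, hK, hodd, h3, hH, hsq1, hsq2, -, hLt, -⟩ :=
    exists_kolyvaginDoorField_of_analyticRank_eq_one hnf hHL W hr
  -- the odd-constant datum, the orientation, the embedding, the conductor-`1` datum
  have hT2 : NoRationalTwoTorsion W := noRationalTwoTorsion_of_odd_torsionOrder W hT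
  obtain ⟨Dt, hc2⟩ := hMan W hT2
  have hcM : Odd Dt.c := Int.not_even_iff_odd.mp fun h => hc2 (even_iff_two_dvd.mp h)
  obtain ⟨β, hβ⟩ : ∃ β : ℤ, (4 * (W.conductorNorm ℤ : ℕ) : ℤ) ∣ β ^ 2 - NumberField.discr K :=
    Literature.NumberTheory.QuadraticFields.Quadratic.exists_dvd_sq_sub_discr_of_ncard_primesOver hK.1 (NeZero.ne _) hH
  obtain ⟨ι⟩ : Nonempty (K →+* ℂ) := inferInstance
  obtain ⟨d₁⟩ := exists_kolyvaginHeegnerData_one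
    (phi_heegnerTau_mem_singularModuliField_holds (W.conductorNorm ℤ) W K) hK Dt β ι hβ
  -- `y_K` has infinite order: `L'(W/K, 1) = L'(W, 1) · L(W^{(d_K)}, 1) ≠ 0` and Gross–Zagier
  haveI hEK : (W.baseChange K).IsElliptic := isElliptic_baseChange' W K
  have hL0 : W.entireLFunction 1 = 0 := entireLFunction_one_eq_zero_of_analyticRank_eq_one hr
  obtain ⟨-, hderiv⟩ := leadingLCoeff_eq_deriv_of_analyticRank_eq_one hr
  have hLK : LDerivEK W K ≠ 0 := by
    rw [lDerivEK_eq_deriv_mul W K hmod hL0]; exact mul_ne_zero hderiv hLt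
  obtain ⟨P₀, Hd, hP₀, hP₀K⟩ := exists_heegnerPoint_map_eq_derivedPoint_one hK hH d₁
  have hP₀inf : ¬ IsOfFinAddOrder P₀ :=
    (lDerivEK_ne_zero_iff_not_isOfFinAddOrder W (W.conductorNorm ℤ) K (hGZ _ W K) hK hH ⟨Dt, Hd, ι, hP₀⟩).mp hLK
  have hy : ¬ IsOfFinAddOrder d₁.derivedPoint := by
    intro hfin
    apply hP₀inf
    rw [← hP₀K] at hfin
    exact (WeierstrassCurve.Affine.Point.map_injective (W' := W) _).isOfFinAddOrder_iff.mp hfin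
  -- `M₀ = ord₂(y_K)` in `E(K[1])` (a number field: finite generation)
  obtain ⟨M₀, hdiv, hndiv⟩ : ∃ M₀ : ℕ,
      (∃ Q : (W.baseChange (ringClassField K ι 1)).toAffine.Point, ((2 ^ M₀ : ℕ) : ℤ) • Q = d₁.derivedPoint) ∧
      ¬ ∃ Q : (W.baseChange (ringClassField K ι 1)).toAffine.Point, ((2 ^ (M₀ + 1) : ℕ) : ℤ) • Q = d₁.derivedPoint := by
    haveI : NumberField (ringClassField K ι 1) := numberField_ringClassField hK ι one_ne_zero
    haveI : (W.baseChange (ringClassField K ι 1)).IsElliptic := by rw [baseChange]; infer_instance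
    haveI : Module.Finite ℤ (W.baseChange (ringClassField K ι 1)).toAffine.Point := by
      convert (W.baseChange (ringClassField K ι 1)).module_finite_point_holds
    exact exists_pow_smul_eq_and_not_of_not_isOfFinAddOrder Nat.prime_two hy
  -- Kolyvagin's conjecture at `2`: a `2`-indivisible derived point
  obtain ⟨n, d, hn, hKoly, hPn⟩ := hKC W hCM hsurj hc hr K hK hodd h3 hH hsq1 hsq2 Dt β ι d₁ hcM hy
  exact bsdp_two_of_kolyvaginExactAtTwo_at hGZ hGZK hmod hMilneC hX hZ W hCM hsurj hc hr K hK hodd h3 hH hsq1 hsq2 Dt hcM β ι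
    d₁ hy M₀ hdiv hndiv n d hn hKoly hPn

/-! ### §3 The rows with `y_K ∉ 2E(K[1])` need no conjecture -/

/-- **Odd Heegner index: `BSD(W, 2)` from `KolyvaginExactAtTwo` with NO Kolyvagin-conjecture input.**  In the setting of
`bsdp_two_of_kolyvaginExactAtTwo_at`, if `y_K = P(1) ∉ 2E(K[1])` (`M₀ = 0`), then `n = 1` (no Kolyvagin prime) is already a
`2`-indivisible derived point, so `KolyvaginExactAtTwo` gives `Ш(E_K)[2^∞] = 0` and the exact descent concludes.
[cite: GrossLMS1991, §4 (P_1 = y_K)] [cite: McCallumLMS1991, §5] -/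
theorem bsdp_two_of_kolyvaginExactAtTwo_at_of_not_two_dvd
    (hGZ : ∀ (N : ℕ) [NeZero N] (W : WeierstrassCurve ℚ) (K : Type) [Field K] [NumberField K], gross_zagier N W K)
    (hGZK : rank_eq_analyticRank_of_analyticRank_le_one) (hmod : hasEntireLFunction_rat)
    (hMilneC : Milne1972.bsdQuotient_baseChange_quadratic_anyModel)
    (hX : KolyvaginExactAtTwo) (hZ : S_rankZeroTwin)
    (W : WeierstrassCurve ℚ) [W.IsElliptic] [W.IsGloballyMinimal] [NeZero (W.conductorNorm ℤ)]
    (hCM : ¬ W.HasCM) (hsurj : ∀ n : ℕ, W.HasSurjectiveModNGaloisRep ((2 ^ n : ℕ) : ℤ)) (hc : Odd W.tamagawaProduct)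
    (hr : W.analyticRank = 1)
    (K : Type) [Field K] [NumberField K] (hK : IsImaginaryQuadratic K) (hodd : Odd (NumberField.discr K))
    (h3 : NumberField.discr K ≠ -3) (hH : SatisfiesHeegnerHypothesis (W.conductorNorm ℤ) K)
    (hsq1 : ¬ IsSquare ((NumberField.discr K : ℚ) * -|W.Δ|))
    (hsq2 : ¬ IsSquare ((NumberField.discr K : ℚ) * (-(2 * |W.Δ|))))
    (Dt : ModularParametrizationData W (W.conductorNorm ℤ)) (hcM : Odd Dt.c) (β : ℤ) (ι : K →+* ℂ)
    (d₁ : KolyvaginHeegnerData Dt β ι 1) (hy : ¬ IsOfFinAddOrder d₁.derivedPoint)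
    (hndiv : ¬ ∃ Q : (W.baseChange (ringClassField K ι 1)).toAffine.Point, (2 : ℤ) • Q = d₁.derivedPoint) :
    BSDp W 2 := by
  refine bsdp_two_of_kolyvaginExactAtTwo_at hGZ hGZK hmod hMilneC hX hZ W hCM hsurj hc hr K hK hodd h3 hH hsq1 hsq2 Dt hcM β ι
    d₁ hy 0 ⟨d₁.derivedPoint, by simp⟩ (by simpa using hndiv) 1 d₁ squarefree_one (by simp) hndiv

end Summit.BirchSwinnertonDyer.BirchSwinnertonDyer.Theorems.RankOneAtTwoOneDoor

end
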